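import Summits.KontsevichZagierPeriods.KontsevichZagierPeriods.Theorems.RootDecompRelativeModAbsoluteRegKernelPairLeOneP08
import Summits.KontsevichZagierPeriods.KontsevichZagierPeriods.Theorems.RootDecompRelativeModAbsoluteRegFoldingDegOneP13

/-!
(second half of the lens part 8 — the core lemma `cyl_commonArctan_mem_relations` — split off by the landing seat to respect the 400-line policy; first half = …RegKernelPairLeOneP08.lean)

(LANDED by the census seat decomp-kz-census-1 g7 `--supports stmt-KontsevichZagierPeriods-30572`; source lens-3 g9 landing package #2, critic decomp-kz-crit-1 g2 CLEARED §14–§17; generic docstrings added where the source had none.)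

# `RegKernelPairDegOne`, the COMMON-ARCTAN case (route `RootDecompRelativeModAbsolute`, support item
stmt-KontsevichZagierPeriods-30572) — PROVED · part 8 (rigidity of two remainders + core lemma)

Cell `decomp-kz`, lens 3 (decomp-kz-lens-3 g9), §17 of the HOME file.  Item 30572 for ANY numbers `k, k'` of
regularised monomials, all of ARCTAN kind (`eᵢ = 2`) and sharing ONE argument function `κ₀ > 0` (`κᵢ = κ'ⱼ =
κ₀`, `ℚ`-semialgebraic on `G ∪ G'`).  This part: `sum_range_even_odd` (parity split), `two_rem_scalar` (Baker in
the MIXED form `CircleBaker.log_arctan` of part 4: for algebraic `κ > 0`, `A + R₀ ℓ_{2n+2,2}(κ) + R₁ ℓ_{2n+3,2}(κ)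
= 0` with algebraic `A, R₀, R₁` forces `R₀ = R₁ = 0`, since `ℓ_{2n+2,2}`, `ℓ_{2n+3,2}` are affine with non-zero
algebraic slope in `arctan √κ/√κ`, `log(1+κ)/(2κ)`), `two_rem_ae_eq_zero` (the a.e. version for
`ℚ`-semialgebraic data: smooth full-measure loci, continuity, dense algebraic points) and the core lemma
`cyl_commonArctan_mem_relations`: a representation on `P × (0,1)` with integrand
`a₀(x) + Σ_{m<2n+2} c_m(x) θ^m/(1+θ²κ(x))`, `κ > 0`, whose fibre integrals vanish a.e. is a relation — Taylor
division of the even and the odd part by `1 + κw` in `w = θ²`, the two remainders vanish a.e., restriction to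
that full-measure piece, polynomial fold, a.e.-zero base integrand.  Part 9: the rung theorem.
(`κ₀ < 0` is NOT covered: there the kernel is logarithmic in `u = √(−κ₀)` and on cells with constant `κ₀` and
multiplicatively dependent `1 ± u` — e.g. `u = 1/φ`, `(1+u)²(1−u) = 1` — the remainders need not vanish.)

Source: `HOME/decomp-kz-lens-3/g9/RelativeModAbsoluteDegOneBands.lean` §17 (v5 sha256 c72c66ad3c72dd77, 7408 l;
farm rc 0 / 0 warn / 0 sorry; `#print axioms regKernelPairDegOne_of_commonArctan` = propext, Classical.choice,
Quot.sound), extracted verbatim into the namespace of the landed chain.  No `sorry`; standard axioms.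
References: Baker 1975 Thm 2.1 [tree: `baker_holds`]; [cite: KontsevichZagier2001, §1.2]; Bochnak–Coste–Roy 1998 §2.9.
-/

noncomputable section

open Set MeasureTheory Filter Topology
open scoped BigOperators
open Literature.NumberTheory.Transcendental Literature.ModelTheory.ExponentialFields

namespace Summit.KontsevichZagierPeriods.RootDecompRelativeModAbsolute.Rung30571

namespace RegularisedLogLayer

/-- (PRIVATE copy — the chain module RegFoldingDegOneP05 keeps this lemma private because its landed twin lives in a farm-unbuilt HyperbolicBloch module.) Finite sums of `ℚ`-semialgebraic functions are `ℚ`-semialgebraic. [BCR 1998, Prop. 2.2.6] -/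
private theorem isSemialgebraicFunOn_finset_sum {n : ℕ} {s : Set (Fin n → ℝ)} (hs : IsSemialgebraic ℚ s)
    {ι : Type*} (I : Finset ι) {f : ι → (Fin n → ℝ) → ℝ}
    (hf : ∀ i ∈ I, IsSemialgebraicFunOn ℚ s (f i)) :
    IsSemialgebraicFunOn ℚ s (fun x => ∑ i ∈ I, f i x) := by
  classical
  induction I using Finset.induction_on with
  | empty => exact (isSemialgebraicFunOn_ratCast hs 0).congr fun x _ => by simp
  | insert a I ha ih =>
    have h1 : IsSemialgebraicFunOn ℚ s (f a) := hf a (Finset.mem_insert_self a I)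
    have h2 := ih fun i hi => hf i (Finset.mem_insert_of_mem hi)
    refine (IsSemialgebraicFunOn.add_holds h1 h2).congr fun x _ => ?_
    simp only [Pi.add_apply, Finset.sum_insert ha]

section CommonArctan

/-- **Core lemma (one common arctan argument, `κ > 0`).** A representation `V` on `P × (0,1)` whose
integrand is `a₀(x) + Σ_{m < 2n+2} c_m(x)·θ^m/(1 + θ²κ(x))` (`a₀, c_m, κ` `ℚ`-semialgebraic on `P`,
`κ > 0` on `P`) and whose fibre integrals vanish a.e. on `P` is a relation.
[Baker1975 Thm 2.1; KZ 2001 §1.2; this file §10.2, §14, §15] -/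
theorem cyl_commonArctan_mem_relations {P : Set (Fin 1 → ℝ)} (hP : IsSemialgebraic ℚ P)
    (V : KZ.IntegralRep (1 + 1)) {a₀ κ : (Fin 1 → ℝ) → ℝ} (n : ℕ) {c : ℕ → (Fin 1 → ℝ) → ℝ}
    (ha₀ : IsSemialgebraicFunOn ℚ P a₀) (hκs : IsSemialgebraicFunOn ℚ P κ)
    (hc : ∀ m, IsSemialgebraicFunOn ℚ P (c m)) (hκ0 : ∀ x ∈ P, 0 < κ x)
    (hdom : V.domain = RTerm.cyl P)
    (hint : EqOn V.integrand (fun z => a₀ (Fin.init z) +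
      ∑ m ∈ Finset.range (2 * n + 2),
        c m (Fin.init z) * kernel m 2 (κ (Fin.init z)) (z (Fin.last 1))) V.domain)
    (hzero : ∀ᵐ x, x ∈ P →
      a₀ x + ∑ m ∈ Finset.range (2 * n + 2), c m x * ell m 2 (κ x) = 0) :
    KZ.of V ∈ KZ.relations := by
  classical
  have hPm : MeasurableSet P := hP.measurableSet_holds
  have hκ1 : ∀ x ∈ P, -1 < κ x := fun x hx => by have := hκ0 x hx; linarith
  -- even / odd coefficient families; Taylor division data in the variable `w = θ²`
  set cE : ℕ → (Fin 1 → ℝ) → ℝ := fun j x => c (2 * j) x with hcE_def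
  set cO : ℕ → (Fin 1 → ℝ) → ℝ := fun j x => c (2 * j + 1) x with hcO_def
  have hcE : ∀ j, IsSemialgebraicFunOn ℚ P (cE j) := fun j => hc _
  have hcO : ∀ j, IsSemialgebraicFunOn ℚ P (cO j) := fun j => hc _
  set sE : ℕ → (Fin 1 → ℝ) → ℝ := fun k x => tayCoeff n (fun i => cE i x) (κ x) k with hsE_def
  set sO : ℕ → (Fin 1 → ℝ) → ℝ := fun k x => tayCoeff n (fun i => cO i x) (κ x) k with hsO_def
  set RE : (Fin 1 → ℝ) → ℝ := fun x => tayRem n (fun i => cE i x) (κ x) with hRE_def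
  set RO : (Fin 1 → ℝ) → ℝ := fun x => tayRem n (fun i => cO i x) (κ x) with hRO_def
  have hsE : ∀ k, IsSemialgebraicFunOn ℚ P (sE k) := fun k =>
    isSemialgebraicFunOn_tayCoeff hP n hcE hκs k
  have hsO : ∀ k, IsSemialgebraicFunOn ℚ P (sO k) := fun k =>
    isSemialgebraicFunOn_tayCoeff hP n hcO hκs k
  have hRE : IsSemialgebraicFunOn ℚ P RE := isSemialgebraicFunOn_tayRem hP n hcE hκs
  have hRO : IsSemialgebraicFunOn ℚ P RO := isSemialgebraicFunOn_tayRem hP n hcO hκs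
  -- the division identity on the cylinder
  have hdiv : ∀ x ∈ P, ∀ θ ∈ Ioo (0 : ℝ) 1,
      ∑ m ∈ Finset.range (2 * n + 2), c m x * kernel m 2 (κ x) θ =
        ∑ k ∈ Finset.range (n + 1), sE k x * θ ^ (2 * k) +
          ∑ k ∈ Finset.range (n + 1), sO k x * θ ^ (2 * k + 1) +
          RE x * kernel (2 * n + 2) 2 (κ x) θ + RO x * kernel (2 * n + 3) 2 (κ x) θ := by
    intro x hx θ hθ
    have hpos : 0 < 1 + θ ^ 2 * κ x := one_add_pow_mul_pos 2 (hκ1 x hx) (Ioo_subset_Icc_self hθ)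
    have hne : 1 + κ x * θ ^ 2 ≠ 0 := by rw [mul_comm]; exact hpos.ne'
    have tE := taylor_div n (fun i => cE i x) (κ x) (θ ^ 2) hne
    have tO := taylor_div n (fun i => cO i x) (κ x) (θ ^ 2) hne
    simp only [hsE_def, hsO_def, hRE_def, hRO_def]
    rw [sum_range_even_odd (fun m => c m x * kernel m 2 (κ x) θ) n]
    have eE : ∑ j ∈ Finset.range (n + 1), c (2 * j) x * kernel (2 * j) 2 (κ x) θ =
        ∑ k ∈ Finset.range (n + 1), tayCoeff n (fun i => cE i x) (κ x) k * (θ ^ 2) ^ k +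
          tayRem n (fun i => cE i x) (κ x) * (θ ^ 2) ^ (n + 1) / (1 + κ x * θ ^ 2) := by
      rw [← tE, Finset.sum_div]
      refine Finset.sum_congr rfl fun j _ => ?_
      simp only [hcE_def, kernel]
      rw [pow_mul θ 2 j, mul_comm (θ ^ 2) (κ x)]
      ring
    have eO : ∑ j ∈ Finset.range (n + 1), c (2 * j + 1) x * kernel (2 * j + 1) 2 (κ x) θ =
        (∑ k ∈ Finset.range (n + 1), tayCoeff n (fun i => cO i x) (κ x) k * (θ ^ 2) ^ k +
          tayRem n (fun i => cO i x) (κ x) * (θ ^ 2) ^ (n + 1) / (1 + κ x * θ ^ 2)) * θ := by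
      rw [← tO, Finset.sum_div, Finset.sum_mul]
      refine Finset.sum_congr rfl fun j _ => ?_
      simp only [hcO_def, kernel]
      rw [pow_succ θ (2 * j), pow_mul θ 2 j, mul_comm (θ ^ 2) (κ x)]
      ring
    rw [eE, eO]
    have r1 : ∑ k ∈ Finset.range (n + 1), tayCoeff n (fun i => cE i x) (κ x) k * θ ^ (2 * k) =
        ∑ k ∈ Finset.range (n + 1), tayCoeff n (fun i => cE i x) (κ x) k * (θ ^ 2) ^ k :=
      Finset.sum_congr rfl fun k _ => by rw [pow_mul θ 2 k]
    have r2 : ∑ k ∈ Finset.range (n + 1), tayCoeff n (fun i => cO i x) (κ x) k * θ ^ (2 * k + 1) =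
        (∑ k ∈ Finset.range (n + 1), tayCoeff n (fun i => cO i x) (κ x) k * (θ ^ 2) ^ k) * θ := by
      rw [Finset.sum_mul]
      exact Finset.sum_congr rfl fun k _ => by rw [pow_succ θ (2 * k), pow_mul θ 2 k, mul_assoc]
    have r3 : kernel (2 * n + 2) 2 (κ x) θ = (θ ^ 2) ^ (n + 1) / (1 + κ x * θ ^ 2) := by
      simp only [kernel]
      rw [show 2 * n + 2 = 2 * (n + 1) by ring, pow_mul θ 2 (n + 1), mul_comm (θ ^ 2) (κ x)]
    have r4 : kernel (2 * n + 3) 2 (κ x) θ = (θ ^ 2) ^ (n + 1) * θ / (1 + κ x * θ ^ 2) := by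
      simp only [kernel]
      rw [show 2 * n + 3 = 2 * (n + 1) + 1 by ring, pow_succ θ (2 * (n + 1)),
        pow_mul θ 2 (n + 1), mul_comm (θ ^ 2) (κ x)]
    rw [r1, r2, r3, r4]
    ring
  -- the fibre-integral identity
  have hI : ∀ x ∈ P, ∑ m ∈ Finset.range (2 * n + 2), c m x * ell m 2 (κ x) =
      ∑ k ∈ Finset.range (n + 1), sE k x / (((2 * k : ℕ) : ℝ) + 1) +
        ∑ k ∈ Finset.range (n + 1), sO k x / (((2 * k + 1 : ℕ) : ℝ) + 1) +
        RE x * ell (2 * n + 2) 2 (κ x) + RO x * ell (2 * n + 3) 2 (κ x) := by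
    intro x hx
    have hk1 := hκ1 x hx
    have ipow : ∀ j : ℕ, IntegrableOn (fun θ : ℝ => θ ^ j) (Ioo (0 : ℝ) 1) := fun j =>
      ((continuous_pow j).integrableOn_Icc (a := (0 : ℝ)) (b := 1)).mono_set Ioo_subset_Icc_self
    have i1 : ∀ k ∈ Finset.range (n + 1),
        Integrable (fun θ : ℝ => sE k x * θ ^ (2 * k)) (volume.restrict (Ioo (0 : ℝ) 1)) :=
      fun k _ => (ipow _).const_mul _
    have i1' : ∀ k ∈ Finset.range (n + 1),
        Integrable (fun θ : ℝ => sO k x * θ ^ (2 * k + 1)) (volume.restrict (Ioo (0 : ℝ) 1)) :=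
      fun k _ => (ipow _).const_mul _
    have i2 : Integrable (fun θ : ℝ => ∑ k ∈ Finset.range (n + 1), sE k x * θ ^ (2 * k))
        (volume.restrict (Ioo (0 : ℝ) 1)) := integrable_finsetSum _ i1
    have i2' : Integrable (fun θ : ℝ => ∑ k ∈ Finset.range (n + 1), sO k x * θ ^ (2 * k + 1))
        (volume.restrict (Ioo (0 : ℝ) 1)) := integrable_finsetSum _ i1'
    have i3 : Integrable (fun θ : ℝ => RE x * kernel (2 * n + 2) 2 (κ x) θ)
        (volume.restrict (Ioo (0 : ℝ) 1)) := (integrableOn_kernel (2 * n + 2) 2 hk1).const_mul _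
    have i4 : Integrable (fun θ : ℝ => RO x * kernel (2 * n + 3) 2 (κ x) θ)
        (volume.restrict (Ioo (0 : ℝ) 1)) := (integrableOn_kernel (2 * n + 3) 2 hk1).const_mul _
    have i23 : Integrable (fun θ : ℝ => ∑ k ∈ Finset.range (n + 1), sE k x * θ ^ (2 * k) +
        ∑ k ∈ Finset.range (n + 1), sO k x * θ ^ (2 * k + 1)) (volume.restrict (Ioo (0 : ℝ) 1)) :=
      i2.add i2'
    have i234 : Integrable (fun θ : ℝ => ∑ k ∈ Finset.range (n + 1), sE k x * θ ^ (2 * k) +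
        ∑ k ∈ Finset.range (n + 1), sO k x * θ ^ (2 * k + 1) +
        RE x * kernel (2 * n + 2) 2 (κ x) θ) (volume.restrict (Ioo (0 : ℝ) 1)) := i23.add i3
    have lhs : ∑ m ∈ Finset.range (2 * n + 2), c m x * ell m 2 (κ x) =
        ∫ θ in Ioo (0 : ℝ) 1, ∑ m ∈ Finset.range (2 * n + 2), c m x * kernel m 2 (κ x) θ := by
      rw [integral_finsetSum _ (fun m _ => (integrableOn_kernel m 2 hk1).const_mul _)]
      refine Finset.sum_congr rfl fun m _ => ?_
      rw [integral_const_mul]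
      rfl
    rw [lhs, setIntegral_congr_fun measurableSet_Ioo (fun θ hθ => hdiv x hx θ hθ),
      integral_add i234 i4, integral_add i23 i3, integral_add i2 i2',
      integral_finsetSum _ i1, integral_finsetSum _ i1', integral_const_mul, integral_const_mul]
    congr 1
    congr 1
    congr 1
    · refine Finset.sum_congr rfl fun k _ => ?_
      rw [integral_const_mul, integral_pow_Ioo]
      ring
    · refine Finset.sum_congr rfl fun k _ => ?_
      rw [integral_const_mul, integral_pow_Ioo]
      ring
  -- rigidity: `RE = RO = 0` a.e. on `P`
  set g₀ : (Fin 1 → ℝ) → ℝ := fun x =>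
    a₀ x + ∑ k ∈ Finset.range (n + 1), sE k x / (((2 * k : ℕ) : ℝ) + 1) +
      ∑ k ∈ Finset.range (n + 1), sO k x / (((2 * k + 1 : ℕ) : ℝ) + 1) with hg₀_def
  have hg₀ : IsSemialgebraicFunOn ℚ P g₀ := by
    refine IsSemialgebraicFunOn.add_holds (IsSemialgebraicFunOn.add_holds ha₀
      (isSemialgebraicFunOn_finset_sum hP _ fun k _ => ?_))
      (isSemialgebraicFunOn_finset_sum hP _ fun k _ => ?_)
    · exact (IsSemialgebraicFunOn.mul_holds (hsE k)
        (isSemialgebraicFunOn_ratCast hP ((1 : ℚ) / ((2 * k : ℕ) + 1)))).congr fun x _ => by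
          simp [div_eq_mul_inv]
    · exact (IsSemialgebraicFunOn.mul_holds (hsO k)
        (isSemialgebraicFunOn_ratCast hP ((1 : ℚ) / ((2 * k + 1 : ℕ) + 1)))).congr fun x _ => by
          simp [div_eq_mul_inv]
  have hrig : ∀ᵐ x, x ∈ P → RE x = 0 ∧ RO x = 0 := by
    refine two_rem_ae_eq_zero hP hg₀ hRE hRO hκs hκ0 n ?_
    filter_upwards [hzero] with x hx hxP
    have h1 := hx hxP
    rw [hI x hxP] at h1
    simp only [hg₀_def]
    linarith
  -- restrict to the full-measure piece `P₀ = {RE = 0, RO = 0}`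
  set P₀ : Set (Fin 1 → ℝ) := {x | x ∈ {y | y ∈ P ∧ RE y = 0} ∧ RO x = 0} with hP₀_def
  have hP₀ : IsSemialgebraic ℚ P₀ :=
    isSemialgebraic_sep_eq_zero (hRO.mono (fun x hx => hx.1) (isSemialgebraic_sep_eq_zero hRE))
  have hP₀m : MeasurableSet P₀ := hP₀.measurableSet_holds
  have hP₀P : P₀ ⊆ P := fun x hx => hx.1.1
  have hnull : volume (P \ P₀) = 0 := by
    rw [measure_eq_zero_iff_ae_notMem]
    filter_upwards [hrig] with x hx hx'
    exact hx'.2 ⟨⟨hx'.1, (hx hx'.1).1⟩, (hx hx'.1).2⟩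
  have hcylP₀ : IsSemialgebraic ℚ (RTerm.cyl P₀) := RTerm.isSemialgebraic_cyl hP₀
  have hsub₀ : RTerm.cyl P₀ ⊆ V.domain := by
    rw [hdom]; exact fun z hz => ⟨hP₀P hz.1, hz.2⟩
  let V₀ : KZ.IntegralRep (1 + 1) := V.restrict _ hcylP₀ hsub₀
  have hVV₀ : KZ.of V - KZ.of V₀ ∈ KZ.relations := by
    refine KZ.IntegralRep.of_sub_of_restrict_mem_relations V hcylP₀ hsub₀ ?_
    refine measure_mono_null (fun z hz => ?_) (KZ.volume_setOf_init_mem_eq_zero hnull)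
    have hz1 : z ∈ RTerm.cyl P := hdom ▸ hz.1
    refine ⟨hz1.1, fun h0 => hz.2 ⟨h0, hz1.2⟩⟩
  -- the polynomial coefficients (degree `≤ 2n+1`)
  set aN : ℕ → (Fin 1 → ℝ) → ℝ := fun m x =>
    (if m = 0 then a₀ x else 0) + (if m % 2 = 0 then sE (m / 2) x else sO (m / 2) x) with haN_def
  set a : Fin (2 * n + 1 + 1) → (Fin 1 → ℝ) → ℝ := fun k x => aN k x with ha_def
  have haN : ∀ m, IsSemialgebraicFunOn ℚ P₀ (aN m) := by
    intro m
    refine IsSemialgebraicFunOn.add_holds ?_ ?_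
    · by_cases hm : m = 0
      · simp only [hm, if_true]; exact ha₀.mono hP₀P hP₀
      · simp only [hm, if_false]
        exact (isSemialgebraicFunOn_ratCast hP₀ 0).congr fun x _ => by simp
    · by_cases hm : m % 2 = 0
      · simp only [hm, if_true]; exact (hsE _).mono hP₀P hP₀
      · simp only [hm, if_false]; exact (hsO _).mono hP₀P hP₀
  have ha : ∀ k, IsSemialgebraicFunOn ℚ P₀ (a k) := fun k => haN k
  have haN_even : ∀ (x : Fin 1 → ℝ) (j : ℕ),
      aN (2 * j) x = (if j = 0 then a₀ x else 0) + sE j x := by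
    intro x j
    have h1 : (2 * j) % 2 = 0 := by omega
    have h2 : (2 * j) / 2 = j := by omega
    simp only [haN_def, h1, h2, if_true]
    by_cases hj : j = 0
    · simp [hj]
    · have : 2 * j ≠ 0 := by omega
      simp [hj, this]
  have haN_odd : ∀ (x : Fin 1 → ℝ) (j : ℕ), aN (2 * j + 1) x = sO j x := by
    intro x j
    have h1 : ¬ ((2 * j + 1) % 2 = 0) := by omega
    have h2 : (2 * j + 1) / 2 = j := by omega
    have h3 : 2 * j + 1 ≠ 0 := by omega
    simp only [haN_def, h1, h2, h3, if_false, zero_add]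
  have hsumA : ∀ (x : Fin 1 → ℝ) (θ : ℝ), ∑ k : Fin (2 * n + 1 + 1), a k x * θ ^ (k : ℕ) =
      a₀ x + (∑ k ∈ Finset.range (n + 1), sE k x * θ ^ (2 * k) +
        ∑ k ∈ Finset.range (n + 1), sO k x * θ ^ (2 * k + 1)) := by
    intro x θ
    rw [Fin.sum_univ_eq_sum_range (fun k => aN k x * θ ^ k) (2 * n + 1 + 1),
      show 2 * n + 1 + 1 = 2 * n + 2 by ring, sum_range_even_odd _ n]
    have hE : ∑ j ∈ Finset.range (n + 1), aN (2 * j) x * θ ^ (2 * j) =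
        a₀ x + ∑ j ∈ Finset.range (n + 1), sE j x * θ ^ (2 * j) := by
      have h2 : ∀ j ∈ Finset.range (n + 1), aN (2 * j) x * θ ^ (2 * j) =
          (if j = 0 then a₀ x else 0) * θ ^ (2 * j) + sE j x * θ ^ (2 * j) := by
        intro j _; rw [haN_even]; ring
      rw [Finset.sum_congr rfl h2, Finset.sum_add_distrib]
      congr 1
      rw [Finset.sum_eq_single 0]
      · simp
      · intro j _ hj; simp [hj]
      · intro h; exact absurd (Finset.mem_range.2 (Nat.succ_pos n)) h
    have hO : ∑ j ∈ Finset.range (n + 1), aN (2 * j + 1) x * θ ^ (2 * j + 1) =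
        ∑ j ∈ Finset.range (n + 1), sO j x * θ ^ (2 * j + 1) :=
      Finset.sum_congr rfl fun j _ => by rw [haN_odd]
    rw [hE, hO]
    ring
  have hsumB : ∀ x : Fin 1 → ℝ, ∑ k : Fin (2 * n + 1 + 1), a k x / ((k : ℕ) + 1) = g₀ x := by
    intro x
    rw [Fin.sum_univ_eq_sum_range (fun k => aN k x / ((k : ℝ) + 1)) (2 * n + 1 + 1),
      show 2 * n + 1 + 1 = 2 * n + 2 by ring, sum_range_even_odd _ n]
    have hE : ∑ j ∈ Finset.range (n + 1), aN (2 * j) x / (((2 * j : ℕ) : ℝ) + 1) =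
        a₀ x + ∑ j ∈ Finset.range (n + 1), sE j x / (((2 * j : ℕ) : ℝ) + 1) := by
      have h2 : ∀ j ∈ Finset.range (n + 1), aN (2 * j) x / (((2 * j : ℕ) : ℝ) + 1) =
          (if j = 0 then a₀ x else 0) / (((2 * j : ℕ) : ℝ) + 1) +
            sE j x / (((2 * j : ℕ) : ℝ) + 1) := by
        intro j _; rw [haN_even]; ring
      rw [Finset.sum_congr rfl h2, Finset.sum_add_distrib]
      congr 1
      rw [Finset.sum_eq_single 0]
      · simp
      · intro j _ hj; simp [hj]
      · intro h; exact absurd (Finset.mem_range.2 (Nat.succ_pos n)) h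
    have hO : ∑ j ∈ Finset.range (n + 1), aN (2 * j + 1) x / (((2 * j + 1 : ℕ) : ℝ) + 1) =
        ∑ j ∈ Finset.range (n + 1), sO j x / (((2 * j + 1 : ℕ) : ℝ) + 1) :=
      Finset.sum_congr rfl fun j _ => by rw [haN_odd]
    rw [hE, hO]
  -- the integrand of `V₀` IS the polynomial, pointwise on `cyl P₀`
  have hpt : ∀ x ∈ P₀, ∀ t ∈ Ioo (0 : ℝ) 1,
      V₀.integrand (Fin.snoc x t) = ∑ k : Fin (2 * n + 1 + 1), a k x * t ^ (k : ℕ) := by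
    intro x hx t ht
    have hmem : (Fin.snoc x t : Fin (1 + 1) → ℝ) ∈ V.domain := by
      rw [hdom]
      refine ⟨?_, ?_⟩
      · rw [Fin.init_snoc]; exact hx.1.1
      · rw [Fin.snoc_last]; exact ht
    show V.integrand (Fin.snoc x t) = _
    rw [hint hmem]
    simp only [Fin.init_snoc, Fin.snoc_last]
    rw [hdiv x hx.1.1 t ht, hsumA, hx.1.2, hx.2]
    ring
  -- fold the polynomial representation `V₀`
  obtain ⟨hTb, hfold⟩ := foldsTo_cyl_polynomial V₀ hP₀ ha rfl (fun z hz => by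
    have hz' : z ∈ RTerm.cyl P₀ := hz
    have e := hpt (Fin.init z) hz'.1 (z (Fin.last 1)) hz'.2
    rw [Fin.snoc_init_self] at e
    exact e)
  have hV₀B : KZ.of V₀ - KZ.of (RTerm.baseRep _ hTb) ∈ KZ.relations := by
    have := hfold.1
    rwa [RTerm.unfold_base] at this
  -- the base term has a.e.-zero integrand
  set B := RTerm.baseRep _ hTb with hB_def
  let Z : KZ.IntegralRep 1 := B.restrict ∅ isSemialgebraic_empty (empty_subset _)
  have hZ : KZ.of Z ∈ KZ.relations :=
    KZ.of_mem_relations_of_volume_eq_zero Z (by simp [Z])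
  have hBZ : KZ.of B - KZ.of Z ∈ KZ.relations := by
    refine AECongr.of_sub_of_mem_relations_of_indicator_ae B Z ?_
    filter_upwards [hzero] with x hx
    rw [show Z.domain = ∅ from rfl, Set.indicator_empty]
    by_cases hxP₀ : x ∈ P₀
    · rw [show B.domain = P₀ from rfl, indicator_of_mem hxP₀]
      show ∑ k : Fin (2 * n + 1 + 1), a k x / ((k : ℕ) + 1) = 0
      rw [hsumB]
      have h1 := hx hxP₀.1.1
      rw [hI x hxP₀.1.1, hxP₀.1.2, hxP₀.2] at h1
      simp only [hg₀_def]
      linarith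
    · rw [show B.domain = P₀ from rfl, indicator_of_notMem hxP₀]
  have e : KZ.of V = (KZ.of V - KZ.of V₀) + ((KZ.of V₀ - KZ.of B) + ((KZ.of B - KZ.of Z) + KZ.of Z)) := by
    abel
  rw [e]
  exact add_mem hVV₀ (add_mem hV₀B (add_mem hBZ hZ))

end CommonArctan

end RegularisedLogLayer

end Summit.KontsevichZagierPeriods.RootDecompRelativeModAbsolute.Rung30571

end
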